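import Literature.NumberTheory.Rogawski1990.CartanRealisation
import Literature.NumberTheory.Rogawski1990.ArchTwistGramEmbedding
import Literature.NumberTheory.QuadraticForms.HermitianSignatureCongruence
import Literature.NumberTheory.Automorphic.AdelicUnitaryGroupDatum
import Literature.NumberTheory.Rogawski1990.AdelicCartanDisc
import HarnessLib

/-!
# The Hasse principle for hermitian forms over a CM field, adelic form: an ADELIC congruence `ᵗ(σ_𝔸 G) · H · G = H′` over
# `𝔸_L = L_∞ × 𝔸_L^∞` (all local conditions at once) descends to a congruence over `L`
# (Landherr 1936; Rogawski 1990 §3.3 Prop. 3.3.1, §3.5 Prop. 3.5.2; Kottwitz 1986 §9)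

Topic `NumberTheory/QuadraticForms`; namespace `Literature.NumberTheory.QuadraticForms`; **THEOREMS ONLY** (no definition, no named fact,
no instance, no notation, no `sorry`).  Cell `pub/hodgecm-mathlib`, ENGINE T1 (crux H413 = `stmt-HodgeConjecture-24833`), row G6 «pre-stabilisation
for the `U(3)` tori», RULING #102 (8) «(a)(i)» of the F0∕P3a desk: the LOCAL–GLOBAL STEP of Kottwitz's criterion [Rogawski1990, Prop. 3.3.1 (→)]
for `G = U(H)` in the currency the blueprint `BLUEPRINT-R6dR7-CartanObsHasse` (0a35b92f) holds after its CFT step (P4): the adelic Cartan class of a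
matching adèle is `x_g = t⋆ · (y ⊗ 1) · t` for a GLOBAL `⋆`-symmetric unit `y`, which says precisely that the hermitian form `H · y` is congruent to
`H` OVER THE ADÈLES, `ᵗ(σ_𝔸 (g t⁻¹)) · H_𝔸 · (g t⁻¹) = (H · y)_𝔸` (§4 below).  HC_CM is proved only modulo the printed citations until rung 0 closes.

THE MATHEMATICS.  Let `L` be a CM field, `σ` its complex conjugation, `F = L⁺`, `𝔸 = 𝔸_L` with `σ_𝔸 = σ ⊗ 1` (★ `adeleConj L`), and
`H, H′ ∈ M_N(L)` `σ`-hermitian with `det ≠ 0`.  By LANDHERR'S THEOREM [Landherr1936; ★ `hermitianMatrices_congruent_iff_invariants`] `H′ = ᵗ(σg) H g`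
for some `g ∈ GL_N(L)` iff (i) `ρ(H)`, `ρ(H′)` have the same positive index at every complex embedding `ρ` of `L` and (ii) `det H′ ∕ det H ∈ N_{L∕L⁺}(Lˣ)`.
An ADELIC congruence `ᵗ(σ_𝔸 G) H_𝔸 G = H′_𝔸`, `G ∈ GL_N(𝔸_L)`, delivers both: (i) its archimedean component `G_∞ ∈ GL_N(L ⊗_ℚ ℝ)` (push along
`𝔸_L → L_∞ ≅ L ⊗_ℚ ℝ = ∏_w ℂ`, §1) is an archimedean congruence, read at each `ρ` by ★ (G-c∞) `Rogawski1990.exists_gl_congr_map_of_twistGram_arch_cm`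
and turned into equal positive indices by Sylvester ★ (G-c) `Landherr.forall_card_pos_eigenvalues_map_eq_of_forall_congr_units` (§2); (ii) taking
determinants (★ `det_twistGram`), `det H′ ∕ det H = σ_𝔸(a) · a` with `a = det G ∈ 𝔸_Lˣ` is an ADELIC NORM (§3) — hence a norm from `Lˣ` by HASSE'S
NORM THEOREM for the quadratic extension `L ∕ L⁺` (O'Meara 65:23), which enters §4 as the ONE hypothesis `hHasse` in the exact shape of the cell's
idelic reading «`algebraMap L 𝔸 b = adeleConj L a * a ⇒ b = z σ(z)`» (row P2 of the blueprint, B-p12; the place-by-place form is ★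
`IsCMField.exists_eq_mul_complexConj_of_forall_isLocalNorm`).  §4 assembles the HASSE PRINCIPLE `exists_gl_twistGram_eq_of_twistGram_adele` and its
Cartan-letter edition `exists_gl_inv_mul_twistGram_eq_of_eq_hermStar_mul_map_mul` (input `x_g = t⋆ (y ⊗ 1) t`, output `H⁻¹ H_{g₀} = y`, `g₀ ∈ GL_N(L)`),
i.e. the sub-chain «P2 + P3 + ★ R6a `exists_gl_twistGram_eq_mul_iff_invariants`» of ★ `Rogawski1990.cartanObsHasse_of_steps` in one call.

* §1 `ringEquiv_mixedSpace_fst_adeleConj`, `ringEquiv_mixedSpace_fst_algebraMap`, `map_algebraMap_map_arch` (`(M ⊗ 1)_∞ = archFormOf M`),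
  **`twistGram_adele_map_arch`** (`(ᵗ(σ_𝔸 G) H_𝔸 G)_∞ = ᵗ((σ⊗1) G_∞) (H ⊗ 1) G_∞`), `isUnit_det_map_arch`;
  §1b (any commutative ring) **`twistGram_coe_mul_inv_eq_mul_of_inv_mul_twistGram_eq`**: `H⁻¹ H_g = t⋆ · Y · t` ⇒ `H_{g t⁻¹} = H · Y` (clearing the Cartan letters);
* §2 **`exists_gl_congr_map_of_twistGram_adele`** (per-embedding complex congruence), **`forall_card_pos_eigenvalues_map_eq_of_twistGram_adele`**
  (equal positive indices) and its Cartan-letter reading **`forall_card_pos_eigenvalues_map_eq_mul_of_inv_mul_twistGram_eq`** = the `hsig` binder of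
  ★ `cartanObsHasse_of_steps` (P3 «signatures») from the identity `H_𝔸⁻¹ H_g = t⋆ (y ⊗ 1) t` alone;
* §3 **`algebraMap_det_eq_of_twistGram_adele`** (`(det H′)_𝔸 = σ_𝔸(det G) · (det H)_𝔸 · det G`), **`algebraMap_det_div_det_eq_adeleConj_mul_of_twistGram_adele`**
  (`(det H′ ∕ det H)_𝔸 = σ_𝔸(a) · a`, `a := det G ∈ 𝔸ˣ`) and the Cartan-letter reading **`algebraMap_det_eq_adeleConj_mul_of_inv_mul_twistGram_eq`**
  (`(det y)_𝔸 = σ_𝔸(a) · a`, `a := det (g t⁻¹)` — the input of the Hasse-norm step behind the `hdisc` binder, P2 «disc»);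
* §4 **`exists_gl_twistGram_eq_of_twistGram_adele`** (adelic congruence ⇒ rational congruence, given `hHasse`), `exists_gl_twistGram_eq_mul_of_twistGram_adele`
  (target `H · y`), **`exists_gl_inv_mul_twistGram_eq_of_eq_hermStar_mul_map_mul`** (from `H_𝔸⁻¹ ᵗ(σ_𝔸 g) H_𝔸 g = t⋆ (y ⊗ 1) t` to `H⁻¹ H_{g₀} = y`, `g₀ ∈ GL_N(L)`).
* §5 (ed. 2) the same three UNCONDITIONALLY — `hHasse` discharged by ★ `Rogawski1990.exists_eq_mul_cmConj_of_algebraMap_eq_adeleConj_mul` (Hasse's norm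
  theorem for `L ∕ L⁺` in adelic form, row P2): **`exists_gl_twistGram_eq_of_twistGram_adele'`** (THE HASSE PRINCIPLE: `ᵗ(σ_𝔸 G) H_𝔸 G = H′_𝔸`, `G ∈ GL_N(𝔸_L)`
  ⇒ `∃ g ∈ GL_N(L), ᵗ(σg) H g = H′`), `exists_gl_twistGram_eq_mul_of_twistGram_adele'`, **`exists_gl_inv_mul_twistGram_eq_of_eq_hermStar_mul_map_mul'`**.

Edition log: ed. 1 = §1–§4 (rf adf5bd98cc377368); ed. 2 = + `import Rogawski1990.AdelicCartanDisc` + §5 (append-only, ed. 1 declarations byte-identical).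

## References
* [Landherr1936HermitianForms] W. Landherr, *Äquivalenz Hermitescher Formen über einem beliebigen algebraischen Zahlkörper*, Abh. Math. Sem.
  Hamburg 11 (1936) 245–248 (classification by rank, discriminant class and signatures; the Hasse principle).
* [Rogawski1990] J. D. Rogawski, *Automorphic Representations of Unitary Groups in Three Variables*, Ann. of Math. Stud. 123 (1990), §3.3
  Prop. 3.3.1 p. 22 (the local conditions at every place), §3.5 Prop. 3.5.2 p. 29.
* [Kottwitz1986] R. E. Kottwitz, *Stable trace formula: elliptic singular terms*, Math. Ann. 275 (1986), §9.
* [Omeara1963] O. T. O'Meara, *Introduction to Quadratic Forms* (1963), §65D Thm. 65:23 (Hasse norm theorem).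
* [BorelJacquet1979] A. Borel, H. Jacquet, PSPM 33.1 (1979), §4.1 (`g = g_∞ g_f`, `G(L ⊗ ℝ) = ∏_{w ∣ ∞} G(L_w)`).
-/

set_option autoImplicit false

noncomputable section

open NumberField NumberField.InfinitePlace NumberField.mixedEmbedding IsDedekindDomain
open scoped Matrix MatrixGroups

namespace Literature.NumberTheory.QuadraticForms

open Literature.NumberTheory.Rogawski1990
open Literature.NumberTheory.Automorphic
open Literature.NumberTheory.Automorphic.UnitaryGroup (archFormOf conjMixed)

variable (L : Type) [Field L] [NumberField L] [IsCMField L] (N : ℕ)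

/-! ## §1 The archimedean component of an adelic congruence -/

section Arch

/-- The archimedean projection `𝔸_L → L_∞ ≅ L ⊗_ℚ ℝ` intertwines `σ ⊗ 1` on the adèles (★ `adeleConj`) with `σ ⊗ 1` on `L ⊗ ℝ` (★ `conjMixed`).
[cite: BorelJacquet1979, §4.1] -/
theorem ringEquiv_mixedSpace_fst_adeleConj (x : AdeleRing (𝓞 L) L) :
    InfiniteAdeleRing.ringEquiv_mixedSpace L (adeleConj L x).1 =
      conjMixed (↥(maximalRealSubfield L)) L (IsCMField.complexConj L) (InfiniteAdeleRing.ringEquiv_mixedSpace L x.1) := by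
  rw [UnitaryGroup.conjMixed_ringEquiv, adeleConj_apply, AdeleRing.smul_fst]

omit [IsCMField L] in
/-- The archimedean component of a principal adèle `x ⊗ 1` is Mathlib's `mixedEmbedding L x`. [cite: BorelJacquet1979, §4.1] -/
theorem ringEquiv_mixedSpace_fst_algebraMap (x : L) :
    InfiniteAdeleRing.ringEquiv_mixedSpace L (algebraMap L (AdeleRing (𝓞 L) L) x).1 = mixedEmbedding L x := by
  rw [AdeleRing.algebraMap_fst, ← InfiniteAdeleRing.mixedEmbedding_eq_algebraMap_comp]

omit [IsCMField L] in
/-- `(M ⊗ 1)_∞ = archFormOf L N M` (entrywise §1). [cite: BorelJacquet1979, §4.1] -/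
theorem map_algebraMap_map_arch (M : Matrix (Fin N) (Fin N) L) :
    (M.map (algebraMap L (AdeleRing (𝓞 L) L))).map
        ((InfiniteAdeleRing.ringEquiv_mixedSpace L).toRingHom.comp (UnitaryGroup.adeleFst L)) =
      archFormOf L N M :=
  Matrix.ext fun i j => by
    simp only [Matrix.map_apply, RingHom.coe_comp, RingEquiv.toRingHom_eq_coe, RingHom.coe_coe, Function.comp_apply]
    exact ringEquiv_mixedSpace_fst_algebraMap L (M i j)

/-- **The archimedean component of a transported Gram matrix**: `(ᵗ(σ_𝔸 G) · H_𝔸 · G)_∞ = ᵗ((σ ⊗ 1) G_∞) · (H ⊗ 1) · G_∞` (★ `twistGram_map` along the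
archimedean projection, §1). [cite: Rogawski1990, §3.3 p. 21] [cite: BorelJacquet1979, §4.1] -/
theorem twistGram_adele_map_arch (H : Matrix (Fin N) (Fin N) L) (G : Matrix (Fin N) (Fin N) (AdeleRing (𝓞 L) L)) :
    (twistGram (adeleConj L) (H.map (algebraMap L (AdeleRing (𝓞 L) L))) G).map
        ((InfiniteAdeleRing.ringEquiv_mixedSpace L).toRingHom.comp (UnitaryGroup.adeleFst L)) =
      twistGram (conjMixed (↥(maximalRealSubfield L)) L (IsCMField.complexConj L)) (archFormOf L N H)
        (G.map ((InfiniteAdeleRing.ringEquiv_mixedSpace L).toRingHom.comp (UnitaryGroup.adeleFst L))) := by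
  rw [twistGram_map (adeleConj L) _ (conjMixed (↥(maximalRealSubfield L)) L (IsCMField.complexConj L)) _ (fun r => ?_) G,
    map_algebraMap_map_arch]
  simp only [RingHom.coe_comp, RingEquiv.toRingHom_eq_coe, RingHom.coe_coe, Function.comp_apply]
  exact ringEquiv_mixedSpace_fst_adeleConj L r

omit [IsCMField L] in
/-- The archimedean component of an invertible adelic matrix is invertible. [cite: BorelJacquet1979, §4.1] -/
theorem isUnit_det_map_arch {G : Matrix (Fin N) (Fin N) (AdeleRing (𝓞 L) L)} (hG : IsUnit G.det) :
    IsUnit (G.map ((InfiniteAdeleRing.ringEquiv_mixedSpace L).toRingHom.comp (UnitaryGroup.adeleFst L))).det := by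
  rw [← RingHom.mapMatrix_apply, ← RingHom.map_det]
  exact hG.map _

end Arch

/-! ## §1b Clearing the Cartan letters: `H⁻¹ H_g = t⋆ · Y · t` is the congruence `H_{g t⁻¹} = H · Y` (any commutative ring) -/

section CartanLetters

variable {R : Type*} [CommRing R] {n : Type*} [Fintype n] [DecidableEq n] (σ : R →+* R) {H : Matrix n n R}

/-- **From a Cartan-class identity to a congruence** (any commutative ring with involution, `det H` a unit): if
`H⁻¹ · ᵗ(σg) H g = t⋆ · Y · t` with `t⋆ = H⁻¹ ᵗ(σt) H` (★ `hermStar`) and `g, t` invertible, then `ᵗ(σ(g t⁻¹)) · H · (g t⁻¹) = H · Y`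
(★ `twistGram_mul`). [cite: Rogawski1990, §3.1 p. 19, §3.5 Prop. 3.5.2 p. 29] -/
theorem twistGram_coe_mul_inv_eq_mul_of_inv_mul_twistGram_eq (hH : IsUnit H.det) {Y : Matrix n n R} (g t : GL n R)
    (hx : H⁻¹ * twistGram σ H (g : Matrix n n R) = hermStar σ H (t : Matrix n n R) * Y * (t : Matrix n n R)) :
    twistGram σ H ((g * t⁻¹ : GL n R) : Matrix n n R) = H * Y := by
  -- clear the inverse: `ᵗ(σg) H g = ᵗ(σt) · (H · Y) · t`
  have h1 : twistGram σ H (g : Matrix n n R) = ((t : Matrix n n R).map σ)ᵀ * (H * Y) * (t : Matrix n n R) := by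
    have e : H * (H⁻¹ * twistGram σ H (g : Matrix n n R)) = H * (hermStar σ H (t : Matrix n n R) * Y * (t : Matrix n n R)) := by rw [hx]
    rw [Matrix.mul_nonsing_inv_cancel_left _ _ hH, hermStar_def] at e
    rw [e]
    simp only [Matrix.mul_assoc]
    rw [Matrix.mul_nonsing_inv_cancel_left _ _ hH]
  have htt : (t : Matrix n n R) * ((t⁻¹ : GL n R) : Matrix n n R) = 1 := by
    rw [← Units.val_mul, mul_inv_cancel, Units.val_one]
  have htt' : (((t⁻¹ : GL n R) : Matrix n n R).map σ)ᵀ * ((t : Matrix n n R).map σ)ᵀ = 1 := by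
    rw [← Matrix.transpose_mul, ← Matrix.map_mul, htt, Matrix.map_one _ (map_zero _) (map_one _), Matrix.transpose_one]
  rw [Units.val_mul, twistGram_mul, h1]
  calc (((t⁻¹ : GL n R) : Matrix n n R).map σ)ᵀ * (((t : Matrix n n R).map σ)ᵀ * (H * Y) * (t : Matrix n n R)) * ((t⁻¹ : GL n R) : Matrix n n R)
      = ((((t⁻¹ : GL n R) : Matrix n n R).map σ)ᵀ * ((t : Matrix n n R).map σ)ᵀ) * (H * Y) *
          ((t : Matrix n n R) * ((t⁻¹ : GL n R) : Matrix n n R)) := by simp only [Matrix.mul_assoc]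
    _ = H * Y := by rw [htt', htt, Matrix.one_mul, Matrix.mul_one]

end CartanLetters

/-! ## §2 Signatures: an adelic congruence gives equal positive indices at every complex embedding -/

section Signatures

/-- **ADELIC CONGRUENCE ⇒ COMPLEX CONGRUENCE AT EVERY EMBEDDING.**  If `ᵗ(σ_𝔸 G) · H_𝔸 · G = H′_𝔸` over `𝔸_L` with `det G` a unit, then at every
`ρ : L →+* ℂ` some `g′ ∈ GL_N(ℂ)` has `g′ᴴ · ρ(H) · g′ = ρ(H′)` (archimedean component §1, then ★ `exists_gl_congr_map_of_twistGram_arch_cm`).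
[cite: Rogawski1990, §3.3 Prop. 3.3.1 (local conditions at `∞`)] [cite: Landherr1936HermitianForms] -/
theorem exists_gl_congr_map_of_twistGram_adele {H H' : Matrix (Fin N) (Fin N) L} {G : Matrix (Fin N) (Fin N) (AdeleRing (𝓞 L) L)}
    (hG : IsUnit G.det)
    (h : twistGram (adeleConj L) (H.map (algebraMap L (AdeleRing (𝓞 L) L))) G = H'.map (algebraMap L (AdeleRing (𝓞 L) L)))
    (ρ : L →+* ℂ) :
    ∃ g' : GL (Fin N) ℂ, (g' : Matrix (Fin N) (Fin N) ℂ)ᴴ * H.map ρ * (g' : Matrix (Fin N) (Fin N) ℂ) = H'.map ρ := by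
  refine exists_gl_congr_map_of_twistGram_arch_cm L N (isUnit_det_map_arch L N hG) ?_ ρ
  rw [← twistGram_adele_map_arch, h, map_algebraMap_map_arch]

/-- **ADELIC CONGRUENCE ⇒ EQUAL SIGNATURES** (Sylvester at every embedding, ★ `Landherr.forall_card_pos_eigenvalues_map_eq_of_forall_congr_units`):
the `hsig` currency of ★ `Rogawski1990.cartanObsHasse_of_steps` ∕ ★ `exists_unitary_conj_inv_mul_twistGram_eq_of_invariants`.
[cite: Landherr1936HermitianForms] [cite: Rogawski1990, §3.3 Prop. 3.3.1, §3.5 Prop. 3.5.2] -/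
theorem forall_card_pos_eigenvalues_map_eq_of_twistGram_adele {H H' : Matrix (Fin N) (Fin N) L}
    {G : Matrix (Fin N) (Fin N) (AdeleRing (𝓞 L) L)} (hG : IsUnit G.det)
    (h : twistGram (adeleConj L) (H.map (algebraMap L (AdeleRing (𝓞 L) L))) G = H'.map (algebraMap L (AdeleRing (𝓞 L) L))) :
    ∀ (ρ : L →+* ℂ) (h₁ : (H.map ρ).IsHermitian) (h₂ : (H'.map ρ).IsHermitian),
      (Finset.univ.filter fun i => 0 < h₁.eigenvalues i).card = (Finset.univ.filter fun i => 0 < h₂.eigenvalues i).card :=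
  Landherr.forall_card_pos_eigenvalues_map_eq_of_forall_congr_units fun ρ => exists_gl_congr_map_of_twistGram_adele L N hG h ρ


/-- **SIGNATURES FROM THE CARTAN-CLASS IDENTITY** — the `hsig` binder of ★ `Rogawski1990.cartanObsHasse_of_steps` (P3 «signatures» of the blueprint),
discharged from its last hypothesis alone: if `H_𝔸⁻¹ · ᵗ(σ_𝔸 g) H_𝔸 g = t⋆ · (y ⊗ 1) · t` with `g, t ∈ GL_N(𝔸_L)`, then `ρ(H)` and `ρ(H · y)` have the same
positive index at every complex embedding `ρ` (§1b: this is the adelic congruence `H_{g t⁻¹} = (H · y)_𝔸`; then §2).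
[cite: Rogawski1990, §3.3 Prop. 3.3.1 (local conditions at `∞`), §3.5 Prop. 3.5.2 p. 29] [cite: Landherr1936HermitianForms] -/
theorem forall_card_pos_eigenvalues_map_eq_mul_of_inv_mul_twistGram_eq {H : Matrix (Fin N) (Fin N) L} (h0 : H.det ≠ 0)
    {y : Matrix (Fin N) (Fin N) L} (g t : GL (Fin N) (AdeleRing (𝓞 L) L))
    (hx : (H.map (algebraMap L (AdeleRing (𝓞 L) L)))⁻¹ *
        twistGram (adeleConj L) (H.map (algebraMap L (AdeleRing (𝓞 L) L))) (g : Matrix (Fin N) (Fin N) (AdeleRing (𝓞 L) L)) =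
      hermStar (adeleConj L) (H.map (algebraMap L (AdeleRing (𝓞 L) L))) (t : Matrix (Fin N) (Fin N) (AdeleRing (𝓞 L) L)) *
        y.map (algebraMap L (AdeleRing (𝓞 L) L)) * (t : Matrix (Fin N) (Fin N) (AdeleRing (𝓞 L) L))) :
    ∀ (ρ : L →+* ℂ) (h₁ : (H.map ρ).IsHermitian) (h₂ : ((H * y).map ρ).IsHermitian),
      (Finset.univ.filter fun i => 0 < h₁.eigenvalues i).card = (Finset.univ.filter fun i => 0 < h₂.eigenvalues i).card := by
  have hHAu : IsUnit (H.map (algebraMap L (AdeleRing (𝓞 L) L))).det := by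
    rw [← RingHom.mapMatrix_apply, ← RingHom.map_det]
    exact (Ne.isUnit h0).map _
  have h2 := twistGram_coe_mul_inv_eq_mul_of_inv_mul_twistGram_eq (adeleConj L) hHAu g t hx
  exact forall_card_pos_eigenvalues_map_eq_of_twistGram_adele L N (Matrix.isUnits_det_units (g * t⁻¹)) (by rw [h2, Matrix.map_mul])

end Signatures

/-! ## §3 Discriminants: an adelic congruence makes `det H′ ∕ det H` an adelic norm -/

section Disc

/-- `(det H′)_𝔸 = σ_𝔸(det G) · (det H)_𝔸 · det G` (★ `det_twistGram` over `𝔸_L`). [cite: Rogawski1990, §3.1 p. 19, §3.3 p. 21] -/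
theorem algebraMap_det_eq_of_twistGram_adele {H H' : Matrix (Fin N) (Fin N) L} {G : Matrix (Fin N) (Fin N) (AdeleRing (𝓞 L) L)}
    (h : twistGram (adeleConj L) (H.map (algebraMap L (AdeleRing (𝓞 L) L))) G = H'.map (algebraMap L (AdeleRing (𝓞 L) L))) :
    algebraMap L (AdeleRing (𝓞 L) L) H'.det =
      adeleConj L G.det * algebraMap L (AdeleRing (𝓞 L) L) H.det * G.det := by
  have e := congrArg Matrix.det h
  rw [det_twistGram, ← RingHom.mapMatrix_apply, ← RingHom.mapMatrix_apply, ← RingHom.map_det, ← RingHom.map_det] at e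
  exact e.symm

/-- **`det H′ ∕ det H` IS AN ADELIC NORM**: `(det H′ ∕ det H)_𝔸 = σ_𝔸(a) · a` with `a := det G ∈ 𝔸_Lˣ` — the discriminant condition of Landherr's
theorem holds LOCALLY EVERYWHERE (finite and infinite places at once); the hypothesis shape of the Hasse-norm step `hHasse` of §4.
[cite: Rogawski1990, §3.3 Prop. 3.3.1 (local conditions)] [cite: Landherr1936HermitianForms] -/
theorem algebraMap_det_div_det_eq_adeleConj_mul_of_twistGram_adele {H H' : Matrix (Fin N) (Fin N) L} (h0 : H.det ≠ 0)
    (G : GL (Fin N) (AdeleRing (𝓞 L) L))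
    (h : twistGram (adeleConj L) (H.map (algebraMap L (AdeleRing (𝓞 L) L))) (G : Matrix (Fin N) (Fin N) (AdeleRing (𝓞 L) L)) =
      H'.map (algebraMap L (AdeleRing (𝓞 L) L))) :
    algebraMap L (AdeleRing (𝓞 L) L) (H'.det / H.det) =
      adeleConj L ((Matrix.GeneralLinearGroup.det G : (AdeleRing (𝓞 L) L)ˣ) : AdeleRing (𝓞 L) L) *
        ((Matrix.GeneralLinearGroup.det G : (AdeleRing (𝓞 L) L)ˣ) : AdeleRing (𝓞 L) L) := by
  have e := algebraMap_det_eq_of_twistGram_adele L N h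
  have hinv : algebraMap L (AdeleRing (𝓞 L) L) H.det * algebraMap L (AdeleRing (𝓞 L) L) H.det⁻¹ = 1 := by
    rw [← map_mul, mul_inv_cancel₀ h0, map_one]
  rw [div_eq_mul_inv, map_mul, e, Matrix.GeneralLinearGroup.val_det_apply]
  calc adeleConj L (G : Matrix (Fin N) (Fin N) (AdeleRing (𝓞 L) L)).det * algebraMap L (AdeleRing (𝓞 L) L) H.det *
        (G : Matrix (Fin N) (Fin N) (AdeleRing (𝓞 L) L)).det * algebraMap L (AdeleRing (𝓞 L) L) H.det⁻¹
      = adeleConj L (G : Matrix (Fin N) (Fin N) (AdeleRing (𝓞 L) L)).det * (G : Matrix (Fin N) (Fin N) (AdeleRing (𝓞 L) L)).det *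
          (algebraMap L (AdeleRing (𝓞 L) L) H.det * algebraMap L (AdeleRing (𝓞 L) L) H.det⁻¹) := by ring
    _ = _ := by rw [hinv, mul_one]


/-- **THE DISCRIMINANT FROM THE CARTAN-CLASS IDENTITY**: if `H_𝔸⁻¹ · ᵗ(σ_𝔸 g) H_𝔸 g = t⋆ · (y ⊗ 1) · t` (`g, t ∈ GL_N(𝔸_L)`), then `det y` is an ADELIC
NORM, `(det y)_𝔸 = σ_𝔸(a) · a` with `a := det (g t⁻¹) ∈ 𝔸_Lˣ` — the input of the Hasse-norm step producing the `hdisc` binder `det y = z σ(z)` of ★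
`Rogawski1990.cartanObsHasse_of_steps` (P2 «disc» of the blueprint). [cite: Rogawski1990, §3.3 Prop. 3.3.1 (local conditions), §3.5 Prop. 3.5.2 p. 29] -/
theorem algebraMap_det_eq_adeleConj_mul_of_inv_mul_twistGram_eq {H : Matrix (Fin N) (Fin N) L} (h0 : H.det ≠ 0)
    {y : Matrix (Fin N) (Fin N) L} (g t : GL (Fin N) (AdeleRing (𝓞 L) L))
    (hx : (H.map (algebraMap L (AdeleRing (𝓞 L) L)))⁻¹ *
        twistGram (adeleConj L) (H.map (algebraMap L (AdeleRing (𝓞 L) L))) (g : Matrix (Fin N) (Fin N) (AdeleRing (𝓞 L) L)) =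
      hermStar (adeleConj L) (H.map (algebraMap L (AdeleRing (𝓞 L) L))) (t : Matrix (Fin N) (Fin N) (AdeleRing (𝓞 L) L)) *
        y.map (algebraMap L (AdeleRing (𝓞 L) L)) * (t : Matrix (Fin N) (Fin N) (AdeleRing (𝓞 L) L))) :
    algebraMap L (AdeleRing (𝓞 L) L) y.det =
      adeleConj L ((Matrix.GeneralLinearGroup.det (g * t⁻¹) : (AdeleRing (𝓞 L) L)ˣ) : AdeleRing (𝓞 L) L) *
        ((Matrix.GeneralLinearGroup.det (g * t⁻¹) : (AdeleRing (𝓞 L) L)ˣ) : AdeleRing (𝓞 L) L) := by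
  have hHAu : IsUnit (H.map (algebraMap L (AdeleRing (𝓞 L) L))).det := by
    rw [← RingHom.mapMatrix_apply, ← RingHom.map_det]
    exact (Ne.isUnit h0).map _
  have h2 := twistGram_coe_mul_inv_eq_mul_of_inv_mul_twistGram_eq (adeleConj L) hHAu g t hx
  have hdiv : (H * y).det / H.det = y.det := by rw [Matrix.det_mul, mul_div_cancel_left₀ _ h0]
  rw [← hdiv]
  exact algebraMap_det_div_det_eq_adeleConj_mul_of_twistGram_adele L N h0 (g * t⁻¹) (by rw [h2, Matrix.map_mul])

end Disc

/-! ## §4 The Hasse principle: adelic congruence ⇒ rational congruence -/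

section Hasse

/-- **HASSE PRINCIPLE FOR HERMITIAN FORMS OVER A CM FIELD (adelic form).**  Let `H, H′ ∈ M_N(L)` be `σ`-hermitian with `det ≠ 0` and suppose
`ᵗ(σ_𝔸 G) · H_𝔸 · G = H′_𝔸` for some `G ∈ GL_N(𝔸_L)` («`H ≅ H′` over every completion `L ⊗ L⁺_v` and over `L ⊗ ℝ`»).  Then — granted Hasse's
norm theorem for `L ∕ L⁺` in its adelic reading `hHasse` («an element of `L` which is `σ_𝔸(a) · a` for an idèle `a` is `z · σ(z)`, `z ∈ Lˣ`») —
`H′ = ᵗ(σg) · H · g` for some `g ∈ GL_N(L)`: signatures by §2, discriminants by §3 + `hHasse`, then LANDHERR ★ `congruent_of_forall_embedding_congruent_of_det`.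
[cite: Landherr1936HermitianForms] [cite: Rogawski1990, §3.3 Prop. 3.3.1 p. 22] [cite: Kottwitz1986, §9] [cite: Omeara1963, §65D Thm. 65:23] -/
theorem exists_gl_twistGram_eq_of_twistGram_adele
    (hHasse : ∀ (b : L) (a : (AdeleRing (𝓞 L) L)ˣ),
      algebraMap L (AdeleRing (𝓞 L) L) b = adeleConj L (a : AdeleRing (𝓞 L) L) * (a : AdeleRing (𝓞 L) L) →
        ∃ z : L, z ≠ 0 ∧ b = z * cmConjRingHom L z)
    {H H' : Matrix (Fin N) (Fin N) L} (hH : (H.map (cmConjRingHom L))ᵀ = H) (hH' : (H'.map (cmConjRingHom L))ᵀ = H')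
    (h0 : H.det ≠ 0) (h0' : H'.det ≠ 0) (G : GL (Fin N) (AdeleRing (𝓞 L) L))
    (h : twistGram (adeleConj L) (H.map (algebraMap L (AdeleRing (𝓞 L) L))) (G : Matrix (Fin N) (Fin N) (AdeleRing (𝓞 L) L)) =
      H'.map (algebraMap L (AdeleRing (𝓞 L) L))) :
    ∃ g : GL (Fin N) L, twistGram (cmConjRingHom L) H (g : Matrix (Fin N) (Fin N) L) = H' := by
  -- discriminants: `det H′ / det H = z σ z`, so `det H = det H′ · (z⁻¹ σ z⁻¹)`
  obtain ⟨z, hz, hzz⟩ := hHasse _ _ (algebraMap_det_div_det_eq_adeleConj_mul_of_twistGram_adele L N h0 G h)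
  have hdet : ∃ w : L, w ≠ 0 ∧ H.det = H'.det * (w * IsCMField.complexConj L w) := by
    refine ⟨z⁻¹, inv_ne_zero hz, ?_⟩
    have hσz : IsCMField.complexConj L z ≠ 0 := (map_ne_zero _).mpr hz
    rw [div_eq_iff h0, cmConjRingHom_apply] at hzz
    rw [map_inv₀, hzz]
    field_simp
  -- signatures at every embedding (§2) and Landherr
  obtain ⟨g, hg⟩ := congruent_of_forall_embedding_congruent_of_det L H H' (by rw [Matrix.transpose_map]; exact hH)
    (by rw [Matrix.transpose_map]; exact hH') h0 h0' (exists_gl_congr_map_of_twistGram_adele L N (Matrix.isUnits_det_units G) h) hdet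
  refine ⟨g, ?_⟩
  rw [Matrix.transpose_map] at hg
  rw [twistGram_def]
  exact hg

/-- The same with target `H · y` for a `⋆`-symmetric `y` with `det y ≠ 0` (`(H·y)_𝔸 = H_𝔸 · y_𝔸`; `H · y` is hermitian by ★ `conjTranspose_mul_eq_self_iff`).
[cite: Rogawski1990, §3.5 Prop. 3.5.2 p. 29] [cite: Landherr1936HermitianForms] -/
theorem exists_gl_twistGram_eq_mul_of_twistGram_adele
    (hHasse : ∀ (b : L) (a : (AdeleRing (𝓞 L) L)ˣ),
      algebraMap L (AdeleRing (𝓞 L) L) b = adeleConj L (a : AdeleRing (𝓞 L) L) * (a : AdeleRing (𝓞 L) L) →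
        ∃ z : L, z ≠ 0 ∧ b = z * cmConjRingHom L z)
    {H : Matrix (Fin N) (Fin N) L} (hH : (H.map (cmConjRingHom L))ᵀ = H) (h0 : H.det ≠ 0)
    {y : Matrix (Fin N) (Fin N) L} (hys : hermStar (cmConjRingHom L) H y = y) (hy0 : IsUnit y.det) (G : GL (Fin N) (AdeleRing (𝓞 L) L))
    (h : twistGram (adeleConj L) (H.map (algebraMap L (AdeleRing (𝓞 L) L))) (G : Matrix (Fin N) (Fin N) (AdeleRing (𝓞 L) L)) =
      H.map (algebraMap L (AdeleRing (𝓞 L) L)) * y.map (algebraMap L (AdeleRing (𝓞 L) L))) :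
    ∃ g : GL (Fin N) L, twistGram (cmConjRingHom L) H (g : Matrix (Fin N) (Fin N) L) = H * y := by
  have hHy : ((H * y).map (cmConjRingHom L))ᵀ = H * y := (conjTranspose_mul_eq_self_iff (cmConjRingHom L) H hH (Ne.isUnit h0) y).mpr hys
  have h0y : (H * y).det ≠ 0 := by rw [Matrix.det_mul]; exact mul_ne_zero h0 hy0.ne_zero
  exact exists_gl_twistGram_eq_of_twistGram_adele L N hHasse hH hHy h0 h0y G (by rw [h, Matrix.map_mul])

/-- **CARTAN-LETTER EDITION (the local–global step of Prop. 3.3.1 (→) in one call).**  If the adelic Cartan class of `g ∈ GL_N(𝔸_L)` is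
`H_𝔸⁻¹ · ᵗ(σ_𝔸 g) H_𝔸 g = t⋆ · (y ⊗ 1) · t` with `t ∈ GL_N(𝔸_L)` (`t⋆ = H_𝔸⁻¹ ᵗ(σ_𝔸 t) H_𝔸`, ★ `hermStar`) and `y ∈ M_N(L)` `⋆`-symmetric with
`det y` a unit — the output of the CFT step «`obs = 0` ⇔ the class is globally represented» — then, granted `hHasse`, some `g₀ ∈ GL_N(L)` has Cartan class
`H⁻¹ · ᵗ(σ g₀) H g₀ = y` (so `g₀ γ g₀⁻¹ ∈ U(H)(L⁺)` for every `γ ∈ U(H)` commuting with `y`, ★ `conj_mem_unitaryGroup_of_twistGram_eq_mul`): indeed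
`ᵗ(σ_𝔸 (g t⁻¹)) H_𝔸 (g t⁻¹) = (H · y)_𝔸` (★ `twistGram_mul`), and §4 applies.  This is the sub-chain «`hdisc` + `hsig` + ★
`exists_gl_twistGram_eq_mul_iff_invariants`» of ★ `Rogawski1990.cartanObsHasse_of_steps`.
[cite: Rogawski1990, §3.3 Prop. 3.3.1 p. 22, §3.5 Prop. 3.5.2 p. 29] [cite: Kottwitz1986, §9] [cite: Landherr1936HermitianForms] -/
theorem exists_gl_inv_mul_twistGram_eq_of_eq_hermStar_mul_map_mul
    (hHasse : ∀ (b : L) (a : (AdeleRing (𝓞 L) L)ˣ),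
      algebraMap L (AdeleRing (𝓞 L) L) b = adeleConj L (a : AdeleRing (𝓞 L) L) * (a : AdeleRing (𝓞 L) L) →
        ∃ z : L, z ≠ 0 ∧ b = z * cmConjRingHom L z)
    {H : Matrix (Fin N) (Fin N) L} (hH : (H.map (cmConjRingHom L))ᵀ = H) (h0 : H.det ≠ 0)
    {y : Matrix (Fin N) (Fin N) L} (hys : hermStar (cmConjRingHom L) H y = y) (hy0 : IsUnit y.det) (g t : GL (Fin N) (AdeleRing (𝓞 L) L))
    (hx : (H.map (algebraMap L (AdeleRing (𝓞 L) L)))⁻¹ *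
        twistGram (adeleConj L) (H.map (algebraMap L (AdeleRing (𝓞 L) L))) (g : Matrix (Fin N) (Fin N) (AdeleRing (𝓞 L) L)) =
      hermStar (adeleConj L) (H.map (algebraMap L (AdeleRing (𝓞 L) L))) (t : Matrix (Fin N) (Fin N) (AdeleRing (𝓞 L) L)) *
        y.map (algebraMap L (AdeleRing (𝓞 L) L)) * (t : Matrix (Fin N) (Fin N) (AdeleRing (𝓞 L) L))) :
    ∃ g₀ : GL (Fin N) L, H⁻¹ * twistGram (cmConjRingHom L) H (g₀ : Matrix (Fin N) (Fin N) L) = y := by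
  have hHAu : IsUnit (H.map (algebraMap L (AdeleRing (𝓞 L) L))).det := by
    rw [← RingHom.mapMatrix_apply, ← RingHom.map_det]
    exact (Ne.isUnit h0).map _
  have h2 := twistGram_coe_mul_inv_eq_mul_of_inv_mul_twistGram_eq (adeleConj L) hHAu g t hx
  obtain ⟨g₀, hg₀⟩ := exists_gl_twistGram_eq_mul_of_twistGram_adele L N hHasse hH h0 hys hy0 (g * t⁻¹) h2
  exact ⟨g₀, by rw [hg₀, Matrix.nonsing_inv_mul_cancel_left _ _ (Ne.isUnit h0)]⟩

end Hasse

/-! ## §5 (ed. 2) The Hasse principle, unconditionally: `hHasse` := ★ `exists_eq_mul_cmConj_of_algebraMap_eq_adeleConj_mul` -/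

section HasseUnconditional

/-- **THE HASSE PRINCIPLE FOR HERMITIAN FORMS OVER A CM FIELD** (adelic form, unconditional): for `H, H′ ∈ M_N(L)` `σ`-hermitian with `det ≠ 0`, an adelic
congruence `ᵗ(σ_𝔸 G) · H_𝔸 · G = H′_𝔸` with `G ∈ GL_N(𝔸_L)` — i.e. `H ≅ H′` over every completion of `L⁺`, finite and infinite — gives `H′ = ᵗ(σg) · H · g` for some
`g ∈ GL_N(L)` (§4 with Hasse's norm theorem for `L ∕ L⁺` ★ `exists_eq_mul_cmConj_of_algebraMap_eq_adeleConj_mul`).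
[cite: Landherr1936HermitianForms] [cite: Rogawski1990, §3.3 Prop. 3.3.1 p. 22] [cite: Omeara1963, §65D Thm. 65:23] [cite: Kottwitz1986, §9] -/
theorem exists_gl_twistGram_eq_of_twistGram_adele' {H H' : Matrix (Fin N) (Fin N) L} (hH : (H.map (cmConjRingHom L))ᵀ = H)
    (hH' : (H'.map (cmConjRingHom L))ᵀ = H') (h0 : H.det ≠ 0) (h0' : H'.det ≠ 0) (G : GL (Fin N) (AdeleRing (𝓞 L) L))
    (h : twistGram (adeleConj L) (H.map (algebraMap L (AdeleRing (𝓞 L) L))) (G : Matrix (Fin N) (Fin N) (AdeleRing (𝓞 L) L)) =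
      H'.map (algebraMap L (AdeleRing (𝓞 L) L))) :
    ∃ g : GL (Fin N) L, twistGram (cmConjRingHom L) H (g : Matrix (Fin N) (Fin N) L) = H' :=
  exists_gl_twistGram_eq_of_twistGram_adele L N exists_eq_mul_cmConj_of_algebraMap_eq_adeleConj_mul hH hH' h0 h0' G h

/-- Unconditional target-`H · y` edition. [cite: Rogawski1990, §3.5 Prop. 3.5.2 p. 29] [cite: Landherr1936HermitianForms] -/
theorem exists_gl_twistGram_eq_mul_of_twistGram_adele' {H : Matrix (Fin N) (Fin N) L} (hH : (H.map (cmConjRingHom L))ᵀ = H) (h0 : H.det ≠ 0)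
    {y : Matrix (Fin N) (Fin N) L} (hys : hermStar (cmConjRingHom L) H y = y) (hy0 : IsUnit y.det) (G : GL (Fin N) (AdeleRing (𝓞 L) L))
    (h : twistGram (adeleConj L) (H.map (algebraMap L (AdeleRing (𝓞 L) L))) (G : Matrix (Fin N) (Fin N) (AdeleRing (𝓞 L) L)) =
      H.map (algebraMap L (AdeleRing (𝓞 L) L)) * y.map (algebraMap L (AdeleRing (𝓞 L) L))) :
    ∃ g : GL (Fin N) L, twistGram (cmConjRingHom L) H (g : Matrix (Fin N) (Fin N) L) = H * y :=
  exists_gl_twistGram_eq_mul_of_twistGram_adele L N exists_eq_mul_cmConj_of_algebraMap_eq_adeleConj_mul hH h0 hys hy0 G h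

/-- **THE LOCAL–GLOBAL STEP OF PROP. 3.3.1 (→) IN ONE CALL, unconditionally**: `H_𝔸⁻¹ · ᵗ(σ_𝔸 g) H_𝔸 g = t⋆ · (y ⊗ 1) · t` (`g, t ∈ GL_N(𝔸_L)`, `y⋆ = y`,
`det y` a unit, `H` hermitian non-degenerate) ⇒ `H⁻¹ · ᵗ(σ g₀) H g₀ = y` for some `g₀ ∈ GL_N(L)` — «`hdisc` + `hsig` + ★ R6a realisation» of ★
`Rogawski1990.cartanObsHasse_of_steps`. [cite: Rogawski1990, §3.3 Prop. 3.3.1 p. 22, §3.5 Prop. 3.5.2 p. 29] [cite: Kottwitz1986, §9] [cite: Landherr1936HermitianForms] -/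
theorem exists_gl_inv_mul_twistGram_eq_of_eq_hermStar_mul_map_mul' {H : Matrix (Fin N) (Fin N) L} (hH : (H.map (cmConjRingHom L))ᵀ = H) (h0 : H.det ≠ 0)
    {y : Matrix (Fin N) (Fin N) L} (hys : hermStar (cmConjRingHom L) H y = y) (hy0 : IsUnit y.det) (g t : GL (Fin N) (AdeleRing (𝓞 L) L))
    (hx : (H.map (algebraMap L (AdeleRing (𝓞 L) L)))⁻¹ *
        twistGram (adeleConj L) (H.map (algebraMap L (AdeleRing (𝓞 L) L))) (g : Matrix (Fin N) (Fin N) (AdeleRing (𝓞 L) L)) =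
      hermStar (adeleConj L) (H.map (algebraMap L (AdeleRing (𝓞 L) L))) (t : Matrix (Fin N) (Fin N) (AdeleRing (𝓞 L) L)) *
        y.map (algebraMap L (AdeleRing (𝓞 L) L)) * (t : Matrix (Fin N) (Fin N) (AdeleRing (𝓞 L) L))) :
    ∃ g₀ : GL (Fin N) L, H⁻¹ * twistGram (cmConjRingHom L) H (g₀ : Matrix (Fin N) (Fin N) L) = y :=
  exists_gl_inv_mul_twistGram_eq_of_eq_hermStar_mul_map_mul L N exists_eq_mul_cmConj_of_algebraMap_eq_adeleConj_mul hH h0 hys hy0 g t hx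

end HasseUnconditional

end Literature.NumberTheory.QuadraticForms

end
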